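import Literature.Computability.QuantumComplexity.QuadraticFourierSamplerProofs
import HarnessLib

/-!
# The exact Walsh coefficient of a quadratic phase function: the machine's Gauss sum is `W(u)`

Topic `Literature/Computability/QuantumComplexity`; sequel of `QuadraticFourierSamplerProofs.lean`
(analysis of the dequantizer of cubic 2-fold Forrelation, machine `CubicForrelationEstimatorMachine.lean`).
The machine evaluates `TOf (liftQ q) n u`, the real part of the Bravyi–Gosset Gauss sum
(`CliffordGaussSums.lean`) of the data read off `q` at `0`, `eᵢ`, `eᵢ ⊕ eⱼ`. This file proves that
for a QUADRATIC `q` this integer IS the Walsh coefficient `W(u) = Σ_x (-1)^{q(x)} (-1)^{u·x}`: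

* **quadratic interpolation** (`eq_qt_of_mem_lowDeg_two`): a function `Q ∈ lowDeg n 2` is its
  quadratic interpolant `Q(0) + Σᵢ (Q(eᵢ)+Q(0)) xᵢ + Σ_{j<l} B_Q(e_l,e_j) x_l x_j` (uniqueness: a
  member of `lowDeg n 2` with vanishing values at `0`, `eᵢ` and vanishing polar form at `(eᵢ,eⱼ)`
  is zero, `eq_zero_of_lowDeg_two`);
* **the Gauss sum reads the interpolant** (`gsum_gdOf`): `Γₙ(gdOf c λ B) = Σ_w (-1)^{[c] ⊕ λ·w ⊕ Σ_{j<l} B_{lj} w_l w_j}`;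
* **`TOf = W`** (`TOf_eq_walsh`): for `q` quadratic and `|u| ≤ n`,
  `(TOf (liftQ q) n u : ℝ) = W(toInput n u)`; consequences: `W(u)` is an integer of absolute value
  `≤ 2ⁿ`, and on the support `TOf ≠ 0` (`TOf_uV_ne_zero`: the sampler lands in the support).

## References

* F. J. MacWilliams, N. J. A. Sloane, *The Theory of Error-Correcting Codes*, 1977, Ch. 15 §2
  (quadratic forms and their symplectic forms; Dickson). [MacWilliamsSloane1977]
* S. Bravyi, D. Gosset, PRL 116 (2016) 250501, App. A (the exponential sums `W(q)`). [BravyiGosset2016]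
-/

noncomputable section

namespace Literature.Computability.QuantumComplexity

namespace QuadSampler

open Finset Complex Literature.Computability.Complexity Literature.Computability.Complexity.F2Elim QuadPolar CHHL2018
open Literature.Computability.Complexity.LowDegree (xorVec xorVec_apply)
open Literature.Computability.Complexity.BLR (toZ toZ_xor toZ_and toZ_injective)
open ForrCode (toInput)
open BravyiGosset BravyiGosset.GData

variable {n : ℕ}

/-! ### Quadratic interpolation over `𝔽₂` -/

/-- The quadratic function with constant `c`, linear coefficients `lam` and couplings `B`
(only `B l j`, `j < l`, is used): `c + Σ_j lam_j x_j + Σ_l Σ_{j<l} B_{lj} x_l x_j`.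
[cite: MacWilliamsSloane1977, Ch. 15 §2] -/
def qt (c : ZMod 2) (lam : Fin n → ZMod 2) (B : Fin n → Fin n → ZMod 2) (x : Fin n → Bool) : ZMod 2 :=
  c + ∑ j, lam j * toZ (x j) + ∑ l, ∑ j ∈ univ.filter (fun j : Fin n => j < l), B l j * toZ (x l) * toZ (x j)

/-- `coord i x = toZ (x i)`. [folklore] -/
theorem coord_eq_toZ (i : Fin n) (x : Fin n → Bool) : coord i x = toZ (x i) := rfl

/-- Constants have degree `≤ d`. [folklore] -/
theorem const_mem_lowDeg (c : ZMod 2) (d : ℕ) : (fun _ : Fin n → Bool => c) ∈ lowDeg n d :=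
  lowDeg_mono (Nat.zero_le d) (fun _ _ => rfl)

/-- **The quadratic interpolant has degree `≤ 2`.** [cite: MacWilliamsSloane1977, Ch. 15 §2] -/
theorem qt_mem_lowDeg (c : ZMod 2) (lam : Fin n → ZMod 2) (B : Fin n → Fin n → ZMod 2) : qt c lam B ∈ lowDeg n 2 := by
  have h1 : (fun x : Fin n → Bool => c + ∑ j, lam j * toZ (x j)) ∈ lowDeg n 2 := by
    have : (fun x : Fin n → Bool => c + ∑ j, lam j * toZ (x j)) = (fun _ => c) + ∑ j, fun x => lam j * (coord j x * 1) := by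
      funext x; simp [coord_eq_toZ, Finset.sum_apply]
    rw [this]
    refine add_mem_lowDeg 2 (const_mem_lowDeg c 2) (sum_mem_lowDeg _ _ 2 fun j _ => smul_mem_lowDeg _ 2 ?_)
    exact lowDeg_mono (by norm_num) (coordMul_mem_lowDeg j 0 (const_mem_lowDeg 1 0))
  have h2 : (fun x : Fin n → Bool => ∑ l, ∑ j ∈ univ.filter (fun j : Fin n => j < l), B l j * toZ (x l) * toZ (x j)) ∈ lowDeg n 2 := by
    have : (fun x : Fin n → Bool => ∑ l, ∑ j ∈ univ.filter (fun j : Fin n => j < l), B l j * toZ (x l) * toZ (x j)) =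
        ∑ l, ∑ j ∈ univ.filter (fun j : Fin n => j < l), fun x : Fin n → Bool => B l j * (coord l x * (coord j x * 1)) := by
      funext x; simp only [Finset.sum_apply, coord_eq_toZ, mul_one, mul_assoc]
    rw [this]
    refine sum_mem_lowDeg _ _ 2 fun l _ => sum_mem_lowDeg _ _ 2 fun j _ => smul_mem_lowDeg _ 2 ?_
    exact coordMul_mem_lowDeg l 1 (coordMul_mem_lowDeg j 0 (const_mem_lowDeg 1 0))
  have : qt c lam B = (fun x : Fin n → Bool => c + ∑ j, lam j * toZ (x j)) +
      fun x : Fin n → Bool => ∑ l, ∑ j ∈ univ.filter (fun j : Fin n => j < l), B l j * toZ (x l) * toZ (x j) := by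
    funext x; rfl
  rw [this]
  exact add_mem_lowDeg 2 h1 h2

/-- Value at `0`. [folklore] -/
theorem qt_zeroV (c : ZMod 2) (lam : Fin n → ZMod 2) (B : Fin n → Fin n → ZMod 2) : qt c lam B zeroV = c := by
  simp [qt, zeroV, Literature.Computability.Complexity.BLR.toZ]

/-- Value at a unit vector: `c + λ_a`. [folklore] -/
theorem qt_ev (c : ZMod 2) (lam : Fin n → ZMod 2) (B : Fin n → Fin n → ZMod 2) (a : Fin n) : qt c lam B (ev a) = c + lam a := by
  unfold qt
  have hlin : ∑ j, lam j * toZ (ev a j) = lam a := by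
    rw [sum_eq_single a]
    · simp [ev, Literature.Computability.Complexity.BLR.toZ]
    · intro j _ hj; simp [ev, hj, Literature.Computability.Complexity.BLR.toZ]
    · intro h; exact absurd (mem_univ a) h
  have hquad : ∑ l, ∑ j ∈ univ.filter (fun j : Fin n => j < l), B l j * toZ (ev a l) * toZ (ev a j) = 0 := by
    refine sum_eq_zero fun l _ => sum_eq_zero fun j hj => ?_
    have hjl : j < l := (mem_filter.1 hj).2
    by_cases hl : l = a
    · have : j ≠ a := fun h => by rw [h, hl] at hjl; exact lt_irrefl _ hjl
      simp [ev, this, Literature.Computability.Complexity.BLR.toZ]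
    · simp [ev, hl, Literature.Computability.Complexity.BLR.toZ]
  rw [hlin, hquad, add_zero]

/-- The quadratic part at `e_a ⊕ e_b` (`a ≠ b`): the single coupling between `a` and `b`. [folklore] -/
theorem qt_quad_pair (B : Fin n → Fin n → ZMod 2) {a b : Fin n} (hab : a ≠ b) :
    ∑ l, ∑ j ∈ univ.filter (fun j : Fin n => j < l), B l j * toZ (xorVec (ev a) (ev b) l) * toZ (xorVec (ev a) (ev b) j) =
      if b < a then B a b else B b a := by
  have e : ∀ i : Fin n, toZ (xorVec (ev a) (ev b) i) = if i = a ∨ i = b then 1 else 0 := by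
    intro i
    by_cases hia : i = a
    · subst hia; simp [ev, hab, Literature.Computability.Complexity.BLR.toZ]
    · by_cases hib : i = b
      · subst hib; simp [ev, hia, Literature.Computability.Complexity.BLR.toZ]
      · simp [ev, hia, hib, Literature.Computability.Complexity.BLR.toZ]
  -- general evaluation for `lo < hi` with `{lo, hi} = {a, b}`: only the term `l = hi`, `j = lo` survives
  suffices key : ∀ lo hi : Fin n, lo < hi → (∀ i : Fin n, (i = a ∨ i = b) ↔ (i = lo ∨ i = hi)) →
      ∑ l, ∑ j ∈ univ.filter (fun j : Fin n => j < l), B l j * toZ (xorVec (ev a) (ev b) l) * toZ (xorVec (ev a) (ev b) j) = B hi lo by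
    rcases lt_or_gt_of_ne hab with h | h
    · rw [if_neg (not_lt.2 h.le)]; exact key a b h fun i => Iff.rfl
    · rw [if_pos h]; exact key b a h fun i => or_comm
  intro lo hi hlt hiff
  have e' : ∀ i : Fin n, toZ (xorVec (ev a) (ev b) i) = if i = lo ∨ i = hi then 1 else 0 := fun i => by
    rw [e i]; exact if_congr (hiff i) rfl rfl
  simp_rw [e']
  refine (Finset.sum_eq_single hi ?_ ?_).trans ?_
  · intro l _ hlhi
    by_cases hllo : l = lo
    · subst hllo
      refine sum_eq_zero fun j hj => ?_
      have hjl : j < l := (mem_filter.1 hj).2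
      have h1 : j ≠ l := ne_of_lt hjl
      have h2 : j ≠ hi := fun h => by rw [h] at hjl; exact lt_asymm hlt hjl
      simp [h1, h2]
    · refine sum_eq_zero fun j _ => ?_
      simp [hllo, hlhi]
  · intro h; exact absurd (mem_univ hi) h
  · refine (Finset.sum_eq_single_of_mem lo (mem_filter.2 ⟨mem_univ _, hlt⟩) ?_).trans ?_
    · intro j hj hjlo
      have hjhi : j ≠ hi := fun h => by rw [h] at hj; exact lt_irrefl _ (mem_filter.1 hj).2
      simp [hjlo, hjhi]
    · simp

/-- **The polar form of the interpolant at unit vectors is the coupling** (for symmetric `B`).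
[cite: MacWilliamsSloane1977, Ch. 15 §2] -/
theorem polar_qt_ev (c : ZMod 2) (lam : Fin n → ZMod 2) {B : Fin n → Fin n → ZMod 2} (hB : ∀ a b, B a b = B b a)
    {a b : Fin n} (hab : a ≠ b) : polar (qt c lam B) (ev a) (ev b) = B a b := by
  unfold polar
  rw [qt_ev, qt_ev, show (fun _ : Fin n => false) = zeroV from rfl, qt_zeroV]
  have hlin : ∑ j, lam j * toZ (xorVec (ev a) (ev b) j) = lam a + lam b := by
    have e : ∀ j, lam j * toZ (xorVec (ev a) (ev b) j) = lam j * toZ (ev a j) + lam j * toZ (ev b j) := by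
      intro j; rw [xorVec_apply, toZ_xor, mul_add]
    rw [sum_congr rfl fun j _ => e j, sum_add_distrib]
    have := qt_ev 0 lam B a
    have h2 := qt_ev 0 lam B b
    simp only [qt, zero_add] at this h2
    have hq0 : ∀ x : Fin n, ∑ l, ∑ j ∈ univ.filter (fun j : Fin n => j < l), B l j * toZ (ev x l) * toZ (ev x j) = 0 := by
      intro x
      have := qt_ev 0 0 B x
      simpa [qt] using this
    rw [hq0 a, add_zero] at this
    rw [hq0 b, add_zero] at h2
    rw [this, h2]
  unfold qt
  rw [hlin, qt_quad_pair B hab]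
  split_ifs with h
  · linear_combination (2 * c + lam a + lam b) * QuadPolar.two_eq_zero
  · rw [hB b a]; linear_combination (2 * c + lam a + lam b) * QuadPolar.two_eq_zero

/-- **Uniqueness**: a function of degree `≤ 2` vanishing at `0` and at the unit vectors, whose polar
form vanishes at pairs of unit vectors, is zero. [cite: MacWilliamsSloane1977, Ch. 15 §2] -/
theorem eq_zero_of_lowDeg_two {D : (Fin n → Bool) → ZMod 2} (hD : D ∈ lowDeg n 2) (h0 : D zeroV = 0)
    (h1 : ∀ a, D (ev a) = 0) (h2 : ∀ a b, polar D (ev a) (ev b) = 0) : D = 0 := by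
  have hpol : ∀ x y, polar D x y = 0 := by
    intro x y
    rw [additive_eq_sum (fun x => polar D x y) (by rw [polar_comm]; exact polar_zero_right _ _) (fun x x' => polar_add_left hD x x' y) x]
    refine sum_eq_zero fun i _ => ?_
    rw [additive_eq_sum (fun y => polar D (ev i) y) (polar_zero_right _ _) (fun y y' => polar_add_right hD _ y y') y]
    simp [h2]
  have hadd : ∀ x y, D (xorVec x y) = D x + D y := by
    intro x y
    have := shift_add_eq_polar D x y
    rw [hpol, show (fun _ : Fin n => false) = zeroV from rfl, h0] at this
    linear_combination this - D x * QuadPolar.two_eq_zero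
  funext x
  rw [additive_eq_sum D h0 hadd x]
  simp [h1]

/-- **Quadratic interpolation**: every `Q ∈ lowDeg n 2` equals its interpolant from the values at
`0`, `eᵢ` and the polar form at `(eᵢ, eⱼ)`. [cite: MacWilliamsSloane1977, Ch. 15 §2] -/
theorem eq_qt_of_mem_lowDeg_two {Q : (Fin n → Bool) → ZMod 2} (hQ : Q ∈ lowDeg n 2) (x : Fin n → Bool) :
    Q x = qt (Q zeroV) (fun a => Q (ev a) + Q zeroV) (fun a b => polar Q (ev a) (ev b)) x := by
  set D : (Fin n → Bool) → ZMod 2 := Q + qt (Q zeroV) (fun a => Q (ev a) + Q zeroV) (fun a b => polar Q (ev a) (ev b)) with hDdef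
  have hB : ∀ a b, polar Q (ev a) (ev b) = polar Q (ev b) (ev a) := fun a b => polar_comm _ _ _
  have hD : D = 0 := by
    refine eq_zero_of_lowDeg_two (add_mem_lowDeg 2 hQ (qt_mem_lowDeg _ _ _)) ?_ ?_ ?_
    · rw [hDdef, Pi.add_apply, qt_zeroV, CharTwo.add_self_eq_zero]
    · intro a
      rw [hDdef, Pi.add_apply, qt_ev]
      linear_combination (Q (ev a) + Q zeroV) * QuadPolar.two_eq_zero
    · intro a b
      by_cases hab : a = b
      · subst hab; exact polar_self _ _
      · have : polar D (ev a) (ev b) = polar Q (ev a) (ev b) + polar (qt (Q zeroV) (fun a => Q (ev a) + Q zeroV)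
            (fun a b => polar Q (ev a) (ev b))) (ev a) (ev b) := by
          simp only [hDdef, polar, Pi.add_apply]; ring
        rw [this, polar_qt_ev _ _ hB hab, CharTwo.add_self_eq_zero]
  have := congrFun hD x
  rw [hDdef, Pi.add_apply, Pi.zero_apply] at this
  exact (CharTwo.add_eq_zero (R := ZMod 2)).1 this

/-! ### The Gauss sum of `gdOf` reads the quadratic interpolant -/

/-- `(-1)^N = sgn (N mod 2)`. [folklore] -/
theorem neg_one_pow_eq_sgnZ (N : ℕ) : (-1 : ℂ) ^ N = ((sgnZ (N : ZMod 2) : ℝ) : ℂ) := by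
  rcases Nat.even_or_odd N with h | h
  · rw [h.neg_one_pow, (ZMod.natCast_eq_zero_iff_even.2 h), sgnZ_zero]; simp
  · rw [h.neg_one_pow]
    have hne : (N : ZMod 2) ≠ 0 := fun h0 => (Nat.not_even_iff_odd.2 h) (ZMod.natCast_eq_zero_iff_even.1 h0)
    rw [sgnZ_of_ne_zero hne]; simp

/-- `[b]` cast from `ℕ`. [folklore] -/
theorem natCast_toNat (b : Bool) : ((b.toNat : ℕ) : ZMod 2) = toZ b := by
  cases b <;> simp [Literature.Computability.Complexity.BLR.toZ]

/-- `ph b = 2 [b]`. [folklore] -/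
theorem ph_eq (b : Bool) : ph b = 2 * b.toNat := by cases b <;> rfl

/-- The inner index range of `expNeg` as a filter of `Fin n`. [folklore] -/
theorem sum_range_eq_sum_filter_lt {M : Type*} [AddCommMonoid M] (l : Fin n) (g : ℕ → M) :
    ∑ j ∈ range l, g j = ∑ j ∈ univ.filter (fun j : Fin n => j < l), g j := by
  symm
  refine Finset.sum_bij (fun (j : Fin n) _ => (j : ℕ)) ?_ ?_ ?_ ?_
  · intro j hj; exact mem_range.2 (mem_filter.1 hj).2
  · intro j₁ _ j₂ _ h; exact Fin.ext h
  · intro k hk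
    exact ⟨⟨k, (mem_range.1 hk).trans l.2⟩, mem_filter.2 ⟨mem_univ _, mem_range.1 hk⟩, rfl⟩
  · intro j _; rfl

/-- **The Gauss sum of `gdOf c λ B` is `Σ_w (-1)^{q̃(w)}`** for the quadratic interpolant read off the
lists (`λ_j = λ.getD j`, `B_{lj} = (B.getD l []).getD j`). [cite: BravyiGosset2016, App. A] -/
theorem gsum_gdOf (cb : Bool) (linL : List Bool) (BL : List (List Bool)) :
    gsum n (gdOf cb linL BL) =
      ∑ w : Fin n → Bool, ((sgnZ (qt (toZ cb) (fun j => toZ (linL.getD j false))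
        (fun l j => toZ ((BL.getD l []).getD j false)) w) : ℝ) : ℂ) := by
  unfold gsum
  refine sum_congr rfl fun w _ => ?_
  -- the exponent of `i` is even: `μ + Σ Λ_j w_j = 2 (c + Σ λ_j w_j)`
  have hI : (gdOf cb linL BL).expI w = 2 * (cb.toNat + ∑ j : Fin n, (linL.getD j false).toNat * (w j).toNat) := by
    unfold GData.expI
    have hmu : (gdOf cb linL BL).mu = 2 * cb.toNat := ph_eq cb
    have hlam : ∀ j : ℕ, (gdOf cb linL BL).lamAt j = 2 * (linL.getD j false).toNat := by
      intro j
      rw [GData.lamAt, gdOf]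
      simp only
      rw [show (0 : ℕ) = ph false from rfl, List.getD_map, ph_eq]
    rw [hmu, Finset.sum_range (fun j => (gdOf cb linL BL).lamAt j * (wbit w j).toNat)]
    simp_rw [wbit_fin, hlam, mul_add, mul_sum, mul_assoc]
  have hN : (gdOf cb linL BL).expNeg w =
      ∑ l : Fin n, ∑ j ∈ univ.filter (fun j : Fin n => j < l), ((BL.getD l []).getD j false && w l && w j).toNat := by
    unfold GData.expNeg
    rw [Finset.sum_range (fun l => ∑ j ∈ range l, ((gdOf cb linL BL).entry l j && wbit w l && wbit w j).toNat)]
    refine sum_congr rfl fun l _ => ?_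
    rw [sum_range_eq_sum_filter_lt l]
    refine sum_congr rfl fun j _ => ?_
    rw [wbit_fin, wbit_fin]
    rfl
  rw [GData.val, hI, I_pow_two_mul, ← pow_add, neg_one_pow_eq_sgnZ]
  congr 2
  rw [hN]
  unfold qt
  push_cast
  simp_rw [natCast_toNat, toZ_and]

/-- The interpolant is additive in the linear coefficients: adding `u` to `λ` adds the dot product
`u · x`. [folklore] -/
theorem qt_add_lin (c : ZMod 2) (lam lam' : Fin n → ZMod 2) (B : Fin n → Fin n → ZMod 2) (x : Fin n → Bool) :
    qt c (lam + lam') B x = qt c lam B x + ∑ j, lam' j * toZ (x j) := by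
  unfold qt
  simp only [Pi.add_apply, add_mul, sum_add_distrib]
  ring

/-! ### `TOf = W` for quadratic `q` -/

section Walsh

variable {q : (Fin n → Bool) → Bool} (hq : toZFun q ∈ lowDeg n 2)
include hq

omit hq in
/-- The constant datum is `q(0)`. [folklore] -/
theorem toZ_cstOf : toZ (cstOf (liftQ q) n) = toZFun q zeroV := by
  rw [cstOf, liftQ, toInput_zeroL]; rfl

omit hq in
/-- The linear data are `q(eⱼ) ⊕ q(0)`. [folklore] -/
theorem toZ_linOf_getD (j : Fin n) : toZ ((linOf (liftQ q) n).getD j false) = toZFun q (ev j) + toZFun q zeroV := by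
  have : (linOf (liftQ q) n).getD j false = toInput n (linOf (liftQ q) n) j := rfl
  rw [this, linOf, toInput_map_range]
  simp only [liftQ, toInput_unitL, toInput_zeroL, toZ_xor, toZFun_apply]

omit hq in
/-- The coupling data are the polar form. [folklore] -/
theorem toZ_bmatOf_getD (l j : Fin n) : toZ (((bmatOf (liftQ q) n).getD l []).getD j false) = polar (toZFun q) (ev l) (ev j) := by
  have h1 : (bmatOf (liftQ q) n).getD l [] = (List.range n).map fun c => bentry (liftQ q) n l c := by
    rw [List.getD_eq_getElem _ _ (by rw [length_bmatOf]; exact l.2), bmatOf_getElem]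
  rw [h1]
  have : ((List.range n).map fun c => bentry (liftQ q) n l c).getD j false = toInput n ((List.range n).map fun c => bentry (liftQ q) n l c) j := rfl
  rw [this, toInput_map_range]
  exact toZ_bentry q l j

/-- **The machine's quadratic data reproduce `q`**: the interpolant of the data read off `q` IS `[q]`.
[cite: MacWilliamsSloane1977, Ch. 15 §2] -/
theorem qt_data_eq (x : Fin n → Bool) :
    qt (toZ (cstOf (liftQ q) n)) (fun j => toZ ((linOf (liftQ q) n).getD j false))
      (fun l j => toZ (((bmatOf (liftQ q) n).getD l []).getD j false)) x = toZFun q x := by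
  rw [eq_qt_of_mem_lowDeg_two hq x, toZ_cstOf]
  congr 1
  · funext j; exact toZ_linOf_getD j
  · funext l j; exact toZ_bmatOf_getD l j

/-- With the frequency `u` xored into the linear data the interpolant becomes `[q](x) + u·x`. [folklore] -/
theorem qt_data_xor_eq (uL : List Bool) (x : Fin n → Bool) :
    qt (toZ (cstOf (liftQ q) n)) (fun j => toZ ((bxorL (linOf (liftQ q) n) uL).getD j false))
      (fun l j => toZ (((bmatOf (liftQ q) n).getD l []).getD j false)) x = toZFun q x + dotZ (bz (toInput n uL)) (bz x) := by
  have e : (fun j : Fin n => toZ ((bxorL (linOf (liftQ q) n) uL).getD j false)) =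
      (fun j : Fin n => toZ ((linOf (liftQ q) n).getD j false)) + fun j : Fin n => toZ (uL.getD j false) := by
    funext j; simp only [Pi.add_apply, getD_bxorL, toZ_xor]
  rw [e, qt_add_lin, qt_data_eq hq]
  rfl

/-- **The Gauss sum of the machine's data is the Walsh coefficient** (as a complex number).
[cite: BravyiGosset2016, App. A] -/
theorem gsum_data_eq_walsh (uL : List Bool) :
    gsum n (gdOf (cstOf (liftQ q) n) (bxorL (linOf (liftQ q) n) uL) (bmatOf (liftQ q) n)) = ((walsh q (toInput n uL) : ℝ) : ℂ) := by
  rw [gsum_gdOf, walsh, Complex.ofReal_sum]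
  refine sum_congr rfl fun w _ => ?_
  rw [qt_data_xor_eq hq, sgnZ_add, twist_eq_sgnZ, Complex.ofReal_mul]

omit hq in
/-- The machine's data are sized by `n` when `|u| ≤ n` (so `sanitize` is the identity). [folklore] -/
theorem sized_data {uL : List Bool} (hu : uL.length ≤ n) :
    (gdOf (cstOf (liftQ q) n) (bxorL (linOf (liftQ q) n) uL) (bmatOf (liftQ q) n)).Sized n := by
  refine ⟨?_, ?_, ?_, ?_, ?_⟩
  · show ph _ < 4; cases cstOf (liftQ q) n <;> decide
  · show (List.map ph _).length ≤ n
    rw [List.length_map, length_bxorL]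
    exact max_le (by simp [linOf]) hu
  · intro x hx
    simp only [gdOf, List.mem_map] at hx
    obtain ⟨b, -, rfl⟩ := hx
    cases b <;> decide
  · show (bmatOf (liftQ q) n).length ≤ n; rw [length_bmatOf]
  · intro row hrow
    obtain ⟨i, -, rfl⟩ := (mem_bmatOf_iff _ row).1 hrow
    simp

/-- **`TOf = W`**: the machine's exact Walsh coefficient of a quadratic `q` at `u` (`|u| ≤ n`) is
`W(u) = Σ_x (-1)^{q(x)} (-1)^{u·x}`. [cite: BravyiGosset2016, App. A] -/
theorem TOf_eq_walsh {uL : List Bool} (hu : uL.length ≤ n) : (TOf (liftQ q) n uL : ℝ) = walsh q (toInput n uL) := by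
  rw [TOf_eq_re, sanitize_eq_self (sized_data hu)]
  have h := toComplex_gaussEval n (gdOf (cstOf (liftQ q) n) (bxorL (linOf (liftQ q) n) uL) (bmatOf (liftQ q) n))
  rw [gsum_data_eq_walsh hq] at h
  have := congrArg Complex.re h
  rw [Complex.ofReal_re] at this
  rw [← this, ← GaussianInt.intCast_re]

/-- `W(u)² ≥ 2ⁿ` on the sampler's outputs (the radical contains `0`). [folklore] -/
theorem two_pow_le_walsh_sq_uV (w : Fin n → Bool) : (2 : ℝ) ^ n ≤ walsh q (uV q w) ^ 2 := by
  classical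
  rw [← card_fiber_mul_two_pow_eq_walsh_sq hq]
  have hpos : 0 < (univ.filter fun w' : Fin n → Bool => uV q w' = uV q w).card := Finset.card_pos.2 ⟨w, by simp⟩
  have : (1 : ℝ) ≤ ((univ.filter fun w' : Fin n → Bool => uV q w' = uV q w).card : ℝ) := by exact_mod_cast hpos
  nlinarith [pow_pos (two_pos : (0 : ℝ) < 2) n]

omit hq in
/-- The select-and-xor fold keeps the accumulator length when the rows are not longer. [folklore] -/
theorem length_foldl_zipWith_sel (M : List (List Bool)) (wl : List Bool) (acc : List Bool)
    (h : ∀ r ∈ M, r.length ≤ acc.length) :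
    ((List.zipWith (fun r b => if b then r else []) M wl).foldl bxorL acc).length = acc.length := by
  induction M generalizing wl acc with
  | nil => simp
  | cons r M ih =>
    cases wl with
    | nil => simp
    | cons b wl =>
      rw [List.zipWith_cons_cons, List.foldl_cons]
      have hsel : (if b then r else []).length ≤ acc.length := by
        cases b
        · simp
        · exact h r List.mem_cons_self
      have hacc : (bxorL acc (if b then r else [])).length = acc.length := by
        rw [length_bxorL, max_eq_left hsel]
      rw [ih wl _ (fun r' hr' => by rw [hacc]; exact h r' (List.mem_cons_of_mem _ hr')), hacc]

omit hq in
/-- **The sampled frequency has length `n`.** [folklore] -/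
theorem length_uOf (q' : List Bool → Bool) (wl : List Bool) : (uOf q' n wl).length = n := by
  rw [uOf, length_bxorL, xorSel, length_foldl_zipWith_sel]
  · simp [ustarOf, zeroL]
  · intro r hr
    obtain ⟨i, -, rfl⟩ := (mem_bmatOf_iff q' r).1 hr
    simp [zeroL]

/-- **The sampler lands in the support**: `TOf ≠ 0` at the sampled frequency. [folklore] -/
theorem TOf_uOf_ne_zero (w : Fin n → Bool) : TOf (liftQ q) n (uOf (liftQ q) n (List.ofFn w)) ≠ 0 := by
  intro h0
  have hlen : (uOf (liftQ q) n (List.ofFn w)).length ≤ n := (length_uOf _ _).le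
  have := TOf_eq_walsh hq hlen
  rw [h0, Int.cast_zero] at this
  have h2 := two_pow_le_walsh_sq_uV hq w
  rw [uV, ← this] at h2
  have : (0 : ℝ) < 2 ^ n := pow_pos two_pos n
  nlinarith

end Walsh

end QuadSampler

end Literature.Computability.QuantumComplexity

end
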